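import Literature.NumberTheory.LFunctions.WeilTwoPrimeCells
import HarnessLib

/-!
# RiemannHypothesis / GroundBarta machinery — LATTICE RIPPLES: the cosine sum of a ripple list

Helper file (`--supports stmt-RiemannHypothesis-18085`; infrastructure for the phantom-ripple moment certificates, memo
`run/shared/lean/pub/rh-explicit/rh-explicit-weil-1/FORMAT-PHANTOM.md`), RH-free, axioms standard.  Seat rh-explicit-weil-1.
`ripplesVal rs t = Σ_{(j,k,A) ∈ rs} A cos(t (j log 2 + k log 3))` — the phantom `P` as a function of its ripple list; evenness,
continuity, the crude bound `|P| ≤ Σ|A|`.  Shared by the chain layer (`…LatticeRippleTChain.lean`) and the level certificate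
(`…PhantomLevel.lean`).  Everything here is proved; no named facts.
-/

set_option linter.dupNamespace false

noncomputable section

open Complex Filter Set MeasureTheory
open scoped Real Topology

namespace Summit.RiemannHypothesis.RiemannHypothesis.Theorems.EvenWinsBeyondArch

open Literature.NumberTheory.LFunctions

/-! ## The cosine sum of a ripple list -/

/-- The frequency `j log 2 + k log 3` of a ripple datum. [folklore] -/
def rippleFreq (r : ℤ × ℤ × ℚ) : ℝ := (r.1 : ℝ) * Real.log 2 + (r.2.1 : ℝ) * Real.log 3

/-- `P(t) = Σ_r A_r cos(t x_r)` for a ripple list `rs = [(j, k, A), …]`. [folklore] -/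
def ripplesVal (rs : List (ℤ × ℤ × ℚ)) (t : ℝ) : ℝ :=
  (rs.map fun r ↦ (r.2.2 : ℝ) * Real.cos (t * rippleFreq r)).sum

/-- `P` is even. [folklore] -/
theorem ripplesVal_neg (rs : List (ℤ × ℤ × ℚ)) (t : ℝ) : ripplesVal rs (-t) = ripplesVal rs t := by
  unfold ripplesVal
  congr 1
  refine List.map_congr_left fun r _ ↦ ?_
  rw [neg_mul, Real.cos_neg]

/-- `P(|t|) = P(t)`. [folklore] -/
theorem ripplesVal_abs (rs : List (ℤ × ℤ × ℚ)) (t : ℝ) : ripplesVal rs |t| = ripplesVal rs t := by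
  rcases le_or_gt 0 t with ht | ht
  · rw [abs_of_nonneg ht]
  · rw [abs_of_neg ht, ripplesVal_neg]

/-- `P` is continuous. [folklore] -/
theorem continuous_ripplesVal (rs : List (ℤ × ℤ × ℚ)) : Continuous (ripplesVal rs) := by
  unfold ripplesVal
  induction rs with
  | nil => simpa using continuous_const
  | cons r rs ih =>
    simp only [List.map_cons, List.sum_cons]
    exact Continuous.add (by fun_prop) ih

/-- `|P(t)| ≤ Σ_r |A_r|`. [folklore] -/
theorem abs_ripplesVal_le (rs : List (ℤ × ℤ × ℚ)) (t : ℝ) :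
    |ripplesVal rs t| ≤ ((rs.map fun r ↦ |r.2.2|).sum : ℚ) := by
  unfold ripplesVal
  induction rs with
  | nil => simp
  | cons r rs ih =>
    simp only [List.map_cons, List.sum_cons]
    push_cast
    refine (abs_add_le _ _).trans (add_le_add ?_ ?_)
    · rw [abs_mul]
      have : |Real.cos (t * rippleFreq r)| ≤ 1 := Real.abs_cos_le_one _
      have h0 : (0 : ℝ) ≤ |((r.2.2 : ℚ) : ℝ)| := abs_nonneg _
      calc |((r.2.2 : ℚ) : ℝ)| * |Real.cos (t * rippleFreq r)| ≤ |((r.2.2 : ℚ) : ℝ)| * 1 :=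
            mul_le_mul_of_nonneg_left this h0
        _ = |((r.2.2 : ℚ) : ℝ)| := by rw [mul_one]
    · exact_mod_cast ih

end Summit.RiemannHypothesis.RiemannHypothesis.Theorems.EvenWinsBeyondArch

end
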